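import Mathlib
import HarnessLib
import Summits.NavierStokesRegularity.NavierStokesRegularity.Theorems.AxisTwistDoorSignConeDefs

/-!
# AxisTwistDoor · crux `TiltDominationLoc` (stmt-NavierStokesRegularity-26991) — VOCABULARY of line «signcone», reshape v7
# (LEAD ns-atd-p1 g5): the FLUX-DECAY forms of the two research rungs

Definitions only (no theorems); route-posited obligation Props of a registered-line skeleton (CONVENTIONS §1), kept next to
`…Theorems.AxisTwistDoorSignConeDefs` (ns-imp-p1 / LEAD g4) whose vocabulary (`IsCore`, `SignCone`, `IsSignSaturated`) they
use.  The axis circulation `Γ_W(r,z,s) = ∮_{S(r,z)} W(s)·e_θ dl = ∫₀^{2π} ⟪W(s)(r cos θ, r sin θ, z), (−sin θ, cos θ, 0)⟫ r dθ` and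
«FLUX DECAY AT THE APEX» (`sup_{𝒬(ρ)} Γ_W → 0`: for every `κ > 0` an apex window `{−ρ² < s < 0, 0 < r < ρ, |z| < ρ}` on which
`Γ_W < κ`) are written out VERBATIM as in crux 26889's `…Theorems.AxisTwistDoorAveragedConeLiouvilleDefs.circ` / `.FluxDecay`
(definitionally equal — the skeleton bridges them by `Iff.rfl`; that module imports the route file and is deliberately not
imported here, lint `theses-cone`).

WHY (reshape v7 of the skeleton `Cruxes/TiltDominationLoc/Lines/signcone.lean`).  In the one-signed Type-I class Lei–Ren–Tian's
final step needs no cone: modulo the shared W4 rung a one-signed class profile with DECAYING APEX FLUX is backward-regular at the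
apex (`…Theorems.AxisTwistDoorTiltDominationLocFluxNondecay.not_isBackwardSingularPoint_of_fluxDecay_core`, LEAD g5 p656233), and a
class profile with two independent one-signed directions whose apex flux decays in a BISECTOR FRAME is backward-regular outright
(`…Theorems.AxisTwistDoorSignConeBisectorFrame.not_isBackwardSingularPoint_of_fluxDecay_bisectorFrame`, p656738).  Hence the v6 rungs
`StubRayRigidity` and `StubProperWedgeRigiditySat` are IMPLIED by the two statements below (and equivalent to them modulo W4),
which name the single quantity that the only proved mechanism produces — crux 26889's `FluxDecayFromShell` (Lei–Ren–Tian
arXiv:2501.08976 §4 on the regular shell).  By the LEAD's census (CENSUS-26991-g5 §9) the open content of either is ONE estimate: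
the control of the twisting term `∮_{S(r,z)} ω_r (v₃ − v̄₃) dl` on regular-shell circles without a pointwise cone.

WHAT THIS IS NOT: nothing is proved or asserted here; both Props are research statements about HYPOTHETICAL Type-I blow-up
profiles — `StubRayFluxDecaySat` is crux 26991 (wall W3 of the NS wall board) on the saturated ray-cone subclass read through
the flux, the SAME WALL, not a smaller problem; `TiltDominationLoc`, W4, W6, the leaf `HalfSpaceWindowDoor.Target` and
Navier–Stokes regularity (Clay A) are OPEN.
-/

noncomputable section

-- the summit and its single sub-problem share the name (CONVENTIONS §1), as in every Theorems file
set_option linter.dupNamespace false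

namespace Summit.NavierStokesRegularity.NavierStokesRegularity.Theorems.AxisTwistDoorSignConeFluxDefs

open MeasureTheory Set Function Filter Topology
open scoped InnerProductSpace RealInnerProductSpace
open Literature.Analysis Literature.Analysis.FluidPDE
open Summit.NavierStokesRegularity.NavierStokesRegularity.Theorems.AxisTwistDoorSignConeDefs

/-- RAY FLUX DECAY, SATURATED FORM (reshape v7 of line `signcone`, LEAD ns-atd-p1 g5; size XL, research — THE WALL read
through the flux).  A core profile with `ω₃ ≥ 0` for which every direction one-signed on some apex cylinder is a non-negative
multiple of `e₃` (a saturated profile with RAY sign cone), backward-singular at the apex, has DECAYING APEX FLUX: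
`sup_{𝒬(ρ)} Γ_w → 0`.  With the shared W4 rung this gives `StubRayRigidity`
(`…FluxNondecay.not_isBackwardSingularPoint_of_fluxDecay_core`); conversely `StubRayRigidity` makes the hypotheses
contradictory.  The conclusion is VERBATIM `…AveragedConeLiouvilleDefs.FluxDecay w`.  Statement of the registered stub
`stub_rayFluxDecaySat` (v7).  HONEST LABEL: same wall as crux 26991. -/
def StubRayFluxDecaySat : Prop :=
  ∀ (C : ℝ) (w : ℝ → EuclideanSpace ℝ (Fin 3) → EuclideanSpace ℝ (Fin 3)),
    IsCore C w → EuclideanSpace.single (2 : Fin 3) (1 : ℝ) ∈ SignCone w →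
      (∀ e : EuclideanSpace ℝ (Fin 3),
          (∃ ρ : ℝ, 0 < ρ ∧ ∀ s : ℝ, -ρ ^ 2 < s → s < 0 →
              ∀ y : EuclideanSpace ℝ (Fin 3), ‖y‖ < ρ → 0 ≤ ⟪curl (w s) y, e⟫_ℝ) →
            ∃ c : ℝ, 0 ≤ c ∧ e = c • EuclideanSpace.single (2 : Fin 3) (1 : ℝ)) →
        IsBackwardSingularPoint w 0 →
          (∀ κ : ℝ, 0 < κ → ∃ ρ : ℝ, 0 < ρ ∧
            ∀ s r z : ℝ, -ρ ^ 2 < s → s < 0 → 0 < r → r < ρ → |z| < ρ →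
              (∫ θ in (0 : ℝ)..(2 * Real.pi),
                ⟪w s (WithLp.toLp 2 ![r * Real.cos θ, r * Real.sin θ, z] : EuclideanSpace ℝ (Fin 3)),
                  (WithLp.toLp 2 ![-Real.sin θ, Real.cos θ, 0] : EuclideanSpace ℝ (Fin 3))⟫_ℝ * r) < κ)

/-- WEDGE FLUX DECAY IN A BISECTOR FRAME, SATURATED FORM (reshape v7 of line `signcone`, LEAD ns-atd-p1 g5; size L–XL,
research — the residue of the dihedral rung read through the flux).  Under the binders of `StubProperWedgeRigiditySat`
(saturated core profile, `e₃ ∈ K`, a second one-signed direction `e ∉ ℝe₃`, sign cone `K` a POINTED PLANAR WEDGE) and a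
backward-singular apex: for SOME bisector frame — a determinant-one linear isometry `L` of `ℝ³` with `L⁻¹e₃ = m/‖m‖`,
`m = e₃ + e/‖e‖` — the conjugated profile `L ∘ w ∘ L⁻¹` (flanked: `|⟪ω', h'⟫| ≤ ω'₃` for a horizontal `h' ≠ 0`, only the spine
component free, `…SignConeBisectorFrame.flank_in_bisectorFrame`) has DECAYING APEX FLUX.  This gives
`StubProperWedgeRigiditySat` outright (`…SignConeBisectorFrame.not_isBackwardSingularPoint_of_fluxDecay_bisectorFrame`).
The last conjunct is VERBATIM `…AveragedConeLiouvilleDefs.FluxDecay (fun t x => L (w t (L.symm x)))`.  Statement of the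
registered stub `stub_wedgeFluxDecaySat` (v7). -/
def StubWedgeFluxDecaySat : Prop :=
  ∀ (C : ℝ) (w : ℝ → EuclideanSpace ℝ (Fin 3) → EuclideanSpace ℝ (Fin 3)),
    IsCore C w → EuclideanSpace.single (2 : Fin 3) (1 : ℝ) ∈ SignCone w → IsSignSaturated w →
      ∀ e ∈ SignCone w, (∀ c : ℝ, e ≠ c • EuclideanSpace.single (2 : Fin 3) (1 : ℝ)) →
        interior (SignCone w) = ∅ → (∀ f : EuclideanSpace ℝ (Fin 3), f ∈ SignCone w → -f ∈ SignCone w → f = 0) →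
          IsBackwardSingularPoint w 0 →
            ∃ L : EuclideanSpace ℝ (Fin 3) ≃ₗᵢ[ℝ] EuclideanSpace ℝ (Fin 3),
              (L : EuclideanSpace ℝ (Fin 3) →L[ℝ] EuclideanSpace ℝ (Fin 3)).det = 1 ∧
              L.symm (EuclideanSpace.single (2 : Fin 3) (1 : ℝ)) =
                (‖(EuclideanSpace.single (2 : Fin 3) (1 : ℝ) : EuclideanSpace ℝ (Fin 3)) + (‖e‖⁻¹ : ℝ) • e‖⁻¹ : ℝ) •
                  ((EuclideanSpace.single (2 : Fin 3) (1 : ℝ) : EuclideanSpace ℝ (Fin 3)) + (‖e‖⁻¹ : ℝ) • e) ∧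
              (∀ κ : ℝ, 0 < κ → ∃ ρ : ℝ, 0 < ρ ∧
                ∀ s r z : ℝ, -ρ ^ 2 < s → s < 0 → 0 < r → r < ρ → |z| < ρ →
                  (∫ θ in (0 : ℝ)..(2 * Real.pi),
                    ⟪L (w s (L.symm (WithLp.toLp 2 ![r * Real.cos θ, r * Real.sin θ, z] : EuclideanSpace ℝ (Fin 3)))),
                      (WithLp.toLp 2 ![-Real.sin θ, Real.cos θ, 0] : EuclideanSpace ℝ (Fin 3))⟫_ℝ * r) < κ)

end Summit.NavierStokesRegularity.NavierStokesRegularity.Theorems.AxisTwistDoorSignConeFluxDefs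

end
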